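import Summits.HodgeConjecture.HodgeConjecture.Theses.PadicSemiregularLift
import Literature.AlgebraicGeometry.KTheory.Determinant
import Literature.AlgebraicGeometry.Modules.LineBundleOfCocycleClass
import Literature.AlgebraicGeometry.Modules.RankOneCocycleIso
import HarnessLib

/-!
# `LineBundleStepLifting`: line bundles extend when their `K₀`-class does

Route `PadicSemiregularLift` of `HodgeConjecture`, support item stmt-HodgeConjecture-13826
(`LineBundleStepLifting`): for any morphism of schemes `f : Y ⟶ Z` and any finite locally free `L` of
rank `1` on `Y`, if `[L] = f^* y` in `K₀(Y)` for some `y ∈ K₀(Z)` then `L ≅ f^* L'` for a rank-`1`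
locally free `L'` on `Z` (the determinant trick: `det : K₀ → Pic` is a homomorphism commuting with
`f^*` and `det [L] = L`; Hartshorne II Ex. 6.11, SGA 6 / Fulton §15.1).

Proof, over the tree's Fulton `K₀` (`Literature.AlgebraicGeometry.KTheory.KZero`): the cocycle-valued
determinant `KZero.det : K₀(X) →+ Ȟ¹(X, 𝒪_X^×)` (`KTheory/Determinant.lean`, built on the Čech
Picard group `CechPic` of `Modules/UnitCocycle.lean` and the determinant class of
`Modules/DeterminantCocycle*.lean`) is natural in `f` (`KZero.det_map`), so the class of `L`
(computed in a rank-one frame system, `detClass_eq_mk`) is `f^*` of the class `det y`; represent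
`det y` by a cocycle `c` and glue the line bundle `L' := lineBundle c` (`Modules/LineBundleOfCocycle*.lean`,
rank `1`, class `[c]`); the pulled-back frame system of `f^*L'` has the pulled-back cocycle
(`FrameSystem.pullback_cocycle_equiv`), hence the same class as `L`, and rank-one framed modules with
the same class are isomorphic (`nonempty_iso_of_cocycle_equiv`, `Modules/RankOneCocycleIso.lean`). Everything is proved; no named facts.

References: [Hartshorne1977] II Ex. 6.11, III Ex. 4.5; [Fulton1998] §15.1.
-/

set_option linter.dupNamespace false

noncomputable section

open CategoryTheory AlgebraicGeometry
open Literature.AlgebraicGeometry.Motives Literature.AlgebraicGeometry.Modules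
open Literature.AlgebraicGeometry.KTheory

namespace Summit.HodgeConjecture.HodgeConjecture.Theorems

/-- **Line bundles extend when their `K₀`-class does** (item `LineBundleStepLifting` of route
`PadicSemiregularLift`): if `L` is finite locally free of rank `1` on `Y` and `[L] = f^* y` in `K₀(Y)`,
then `L ≅ f^* L'` for some rank-`1` locally free `L'` on `Z` — by the cocycle-valued determinant
`det : K₀ → Ȟ¹(–, 𝒪^×)`, its naturality, and the classification of line bundles by their cocycle class. -/
theorem lineBundleStepLifting_proof :
    Summit.HodgeConjecture.HodgeConjecture.Theses.PadicSemiregularLift.LineBundleStepLifting := by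
  intro Y Z f L hL hL1 hy
  obtain ⟨y, hy⟩ := hy
  -- a rank-one frame system of `L`
  obtain ⟨FL, hFL⟩ := exists_frameSystem_of_hasRank hL1
  -- a cocycle representing `det y ∈ Ȟ¹(Z, 𝒪_Z^×)` and the glued line bundle
  obtain ⟨c, hc⟩ := CechPic.mk_surjective (Additive.toMul (KZero.det y))
  refine ⟨lineBundle c, c.hasRank_lineBundle, ?_⟩
  -- the class of `L` is the pull-back of the class of `c`
  have hclass : CechPic.mk ((c.lineBundleFrameSystem.pullback f).cocycle) = CechPic.mk FL.cocycle := by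
    rw [CechPic.sound (c.lineBundleFrameSystem.pullback_cocycle_equiv f), ← CechPic.pullback_mk,
      c.mk_lineBundleFrameSystem_cocycle, hc, ← detClass_eq_mk hL FL]
    have h := KZero.det_map f y
    rw [hy, KZero.det_of] at h
    rw [← toMul_ofMul (detClass hL), h, toMul_ofMul]
  -- rank-one framed modules with the same class are isomorphic
  exact nonempty_iso_of_cocycle_equiv (c.lineBundleFrameSystem.pullback f) FL (fun _ => rfl) hFL hclass

end Summit.HodgeConjecture.HodgeConjecture.Theorems

end
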